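import Literature.Probability.Percolation.TileFamilyOfZones
import HarnessLib

/-!
# The family of tile domains of the gluing zones, with the squares wet by fiat

Topic `Probability/Percolation`.  Support file (definitions and proofs, no named fact) for step (C)
of the proof of Schramm–Smirnov's Prop. 4.1 (Ann. Probab. 39 (2011), §4).  Companion of
`TileFamilyOfZones.lean`: the same construction of one `TileData` per accessibility class, but
with the faces touching an excised square declared wet (`Zones.SqFace`).  With this convention the
squares are walls of the link domain like the closed beaches, the terminality package of
`PortOwners.lean` holds at the squares vacuously (a dry face never touches a square), and the only
trace left by the squares on the boundary of the link domain are the square bond cells next to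
accessible site cells (`PortCountSq.lean`).  The convention is legitimate on the event that no hub
vertex of the collar shares a face with a square (`hASQ`): for fixed squares its complement is a
one-arm event at finitely many sites, of probability `→ 0` with the mesh.

* `Zones.SqFace`, `Zones.tileDataClsSq`, `Zones.tileFamilySq`, `mem_accU_tileFamilySq_iff`.

Everything is proved; no named fact is introduced.

## References

* O. Schramm, S. Smirnov, Ann. Probab. 39 (2011), arXiv:1101.5820, §4, proof of Prop. 4.1 (the
  modification `ω̃`, the sets `M`, `M'`). [SchrammSmirnov2011]
-/

noncomputable section

open Set Relation
open Literature.Probability.LatticeModels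
open scoped Classical

namespace Literature.Probability.Percolation

namespace Seeded

namespace Zones

variable (𝒵 : Zones) {X : Finset (Sym2 (Site 2))} {ω : BondConfig (Site 2)}

open CellComplex

/-- **Square faces**: faces with a corner in the excised set `SQ`. [folklore] -/
def SqFace (f : Site 2) : Prop := ∃ q, TouchesFace q f ∧ q ∈ 𝒵.SQ

variable {𝒵}

/-! ### The tile data of one class, squares wet by fiat -/

/-- **The tile data of one accessibility class at terminality, with the faces at the squares wet by
fiat.**  As `Zones.tileDataCls`, but the wet faces are the dual-wet faces together with the faces
touching an excised square (`SqFace`); legitimate when no hub vertex of the collar shares a face with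
a square (`hASQ`, an event of probability `→ 1` as the mesh `→ 0` for fixed squares), which makes the
terminality axiom at such faces vacuous. [cite: SchrammSmirnov2011, §4, proof of Prop. 4.1 (one piece of M', the modification ω̃)] -/
def tileDataClsSq (hT : IsTerminal 𝒵.seeds X ω) (hN : 𝒵.Nice')
    (hASQ : ∀ w ∈ 𝒵.K, OReach 𝒵.seeds X ω w → ∀ f, TouchesFace w f → ¬ 𝒵.SqFace f)
    {e₀ : Sym2 (Site 2)} (he₀ : e₀ ∈ 𝒵.tubeEdges) : TileData where
  O := {v | OReach 𝒵.seeds X ω v}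
  hubE := {e | e ∈ X ∧ e ∈ ω}
  clE := {e | e ∈ X ∧ e ∉ ω}
  Dset := {f | DReach 𝒵.seeds X ω f ∨ 𝒵.SqFace f}
  acc := 𝒵.accCls X ω e₀
  Wv := 𝒵.Wv
  acc_edge e he := 𝒵.mem_edgeSet_of_mem_fresh (mem_accCls_iff.1 he).1
  acc_window e he := fresh_endpoints' hT hN (mem_accCls_iff.1 he).1
  acc_not_hub e he h := 𝒵.not_mem_of_mem_fresh hT.subset (mem_accCls_iff.1 he).1 h.1
  acc_not_cl e he h := 𝒵.not_mem_of_mem_fresh hT.subset (mem_accCls_iff.1 he).1 h.1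
  hub_edge e he := 𝒵.seeds.A_subset e (hT.subset he.1)
  hub_O e he v hv := hT.oReach_of_mem he.1 he.2 hv
  cl_O e he := (hT.two_arms e he.1).1
  cl_D e he f hf := Or.inl (hT.dReach_of_mem he.1 he.2 hf)
  closure e he w hwe hwO e' he'E hwe' hwin := by
    by_cases he'X : e' ∈ X
    · by_cases he'ω : e' ∈ ω
      · exact Or.inl ⟨he'X, he'ω⟩
      · exact Or.inr (Or.inl ⟨he'X, he'ω⟩)
    · right; right
      exact mem_accCls_step (acc_of_mem_tubeEdges he₀) he (𝒵.fresh_of_window he'E hwin he'X) hwe hwe' hwO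
  T3 f hf' w hwO e₁ he₁ e₂ he₂ hne hw₁ hw₂ hf₁ hf₂ := by
    -- a fiat-wet face at a hub corner: the hub is far (then the face is a seed face) or in `K` (excluded)
    have hf : DReach 𝒵.seeds X ω f := by
      rcases hf' with hf | hsq
      · exact hf
      · have hwf : TouchesFace w f := touchesFace_of_isFaceOf (𝒵.mem_edgeSet_of_mem_fresh (mem_accCls_iff.1 he₁).1) hf₁ hw₁
        rcases 𝒵.mem_K_or_Far_of_oReach hT hwO with hK | hF
        · exact absurd hsq (hASQ w hK hwO f hwf)
        · exact dReach_of_mem_seeds X ω ⟨w, hwf, hF⟩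
    have hne1 : ∀ j : Fin 4, j + 1 ≠ j := by decide
    have hne3 : ∀ j : Fin 4, j + 3 ≠ j := by decide
    obtain ⟨he₁f, -⟩ := mem_accCls_iff.1 he₁
    obtain ⟨he₂f, -⟩ := mem_accCls_iff.1 he₂
    have key : ∀ e, e ∈ 𝒵.fresh X → w ∈ e → IsFaceOf f e → e ∈ 𝒵.tubeEdges := by
      intro e hef hwe hfe
      rcases 𝒵.mem_fresh_iff.1 hef with ⟨heA, heX⟩ | het
      · exact absurd hf (hT.not_dReach_of_not_mem heA heX hwe hwO hfe)
      · exact het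
    have ht₁ := key e₁ he₁f hw₁ hf₁
    have ht₂ := key e₂ he₂f hw₂ hf₂
    have hwK : w ∈ 𝒵.K := by
      rcases 𝒵.mem_K_or_Far_of_oReach hT hwO with h | h
      · exact h
      · exact absurd (fresh_endpoints' hT hN he₁f w hw₁) (𝒵.not_mem_Wv_of_mem_Far h)
    have hwf : TouchesFace w f := touchesFace_of_isFaceOf (𝒵.mem_edgeSet_of_mem_fresh he₁f) hf₁ hw₁
    obtain ⟨j, hj⟩ := touchesFace_iff_exists_cornerOff.1 hwf
    have he₁E := 𝒵.mem_edgeSet_of_mem_fresh he₁f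
    have he₂E := 𝒵.mem_edgeSet_of_mem_fresh he₂f
    have hs₁ := faceSide_of_mem_corner he₁E hf₁ (hj ▸ hw₁)
    have hs₂ := faceSide_of_mem_corner he₂E hf₂ (hj ▸ hw₂)
    have hsides : ∀ e, (e = faceSide f j ∨ e = faceSide f (j + 3)) → e ∈ 𝒵.tubeEdges := by
      rintro e (rfl | rfl)
      · rcases hs₁ with h | h
        · exact h ▸ ht₁
        · rcases hs₂ with h' | h'
          · exact h' ▸ ht₂
          · exact absurd (h.trans h'.symm) hne
      · rcases hs₁ with h | h
        · rcases hs₂ with h' | h'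
          · exact absurd (h.trans h'.symm) hne
          · exact h' ▸ ht₂
        · exact h ▸ ht₁
    have hwN : w ∉ 𝒵.N := fun h => Finset.disjoint_left.1 𝒵.disjoint_K_N hwK h
    have hN_of_side : ∀ e ∈ 𝒵.tubeEdges, w ∈ e → ∀ v ∈ e, v ≠ w → v ∈ 𝒵.N := by
      intro e het hwe v hve hvw
      obtain ⟨-, ⟨u, hue, huN⟩, -⟩ := 𝒵.mem_tubeEdges_iff.1 het
      by_cases huw : u = w
      · exact absurd (huw ▸ huN) hwN
      · have he : e = s(u, w) := (Sym2.mem_and_mem_iff huw).1 ⟨hue, hwe⟩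
        rw [he, Sym2.mem_iff] at hve
        rcases hve with rfl | rfl
        · exact huN
        · exact absurd rfl hvw
    have hc1 : f + cornerOff (j + 1) ∈ 𝒵.N := by
      refine hN_of_side _ (hsides _ (Or.inl rfl)) (mem_faceSide_iff.2 (Or.inl hj)) _
        (mem_faceSide_iff.2 (Or.inr rfl)) fun h => ?_
      exact hne1 j (cornerOff_add_inj f (h.trans hj))
    have hc3 : f + cornerOff (j + 3) ∈ 𝒵.N := by
      refine hN_of_side _ (hsides _ (Or.inr rfl)) (mem_faceSide_iff.2 (Or.inr (by rw [fin4_add_three_add_one]; exact hj))) _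
        (mem_faceSide_iff.2 (Or.inl rfl)) fun h => ?_
      exact hne3 j (cornerOff_add_inj f (h.trans hj))
    have hc2 : f + cornerOff (j + 2) ∈ 𝒵.K ∨ f + cornerOff (j + 2) ∈ 𝒵.N ∨ f + cornerOff (j + 2) ∈ 𝒵.SQ := by
      have : f + cornerOff (j + 2) = f + cornerOff (j + 1) + cornerUnit (j + 1) := by
        rw [cornerUnit_eq_off_sub, fin4_add_one_add_one]; abel
      rw [this]
      exact hN.N_nbr _ hc1 (j + 1)
    rcases exists_mem_of_dReach hf with hD₀ | ⟨c, hcX, hcω, hfc⟩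
    · obtain ⟨s, hsf, hsFar⟩ := hD₀
      obtain ⟨m, rfl⟩ := touchesFace_iff_exists_cornerOff.1 hsf
      obtain ⟨i, rfl⟩ := fin4_exists_add j m
      fin_cases i
      · simp only [Fin.zero_eta, add_zero] at hsFar
        exact hsFar.1 (hj ▸ hwK)
      · simp only [Fin.mk_one] at hsFar
        exact hsFar.2.1 hc1
      · simp only [Fin.reduceFinMk] at hsFar
        rcases hc2 with h | h | h
        · exact hsFar.1 h
        · exact hsFar.2.1 h
        · exact hsFar.2.2 h
      · simp only [Fin.reduceFinMk] at hsFar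
        exact hsFar.2.1 hc3
    · have hcA := hT.subset hcX
      have hcE := 𝒵.seeds.A_subset c hcA
      obtain ⟨m, rfl⟩ := (isFaceOf_iff_exists_faceSide hcE).1 hfc
      obtain ⟨i, rfl⟩ := fin4_exists_add j m
      have hKF : ∀ v ∈ faceSide f (j + i), v ∈ 𝒵.K ∨ v ∈ 𝒵.Far := (𝒵.collar.mem_A_iff.1 hcA).2.2
      have hnotN : ∀ v ∈ faceSide f (j + i), v ∉ 𝒵.N := fun v hv hvN => by
        rcases hKF v hv with h | h
        · exact Finset.disjoint_left.1 𝒵.disjoint_K_N h hvN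
        · exact h.2.1 hvN
      have hfreshX : ∀ e ∈ 𝒵.tubeEdges, e ∉ X := fun e het heX =>
        𝒵.not_mem_A_of_mem_tubeEdges het (hT.subset heX)
      fin_cases i
      · exact hfreshX _ (hsides _ (Or.inl (by simp))) hcX
      · exact hnotN _ (mem_faceSide_iff.2 (Or.inl rfl)) (by simpa using hc1)
      · refine hnotN _ (mem_faceSide_iff.2 (Or.inr ?_)) hc3
        simp only [Fin.reduceFinMk]; rw [LatticeModels.fin4_add_two_add_one]
      · exact hfreshX _ (hsides _ (Or.inr (by simp))) hcX
  acc_nonO e he := by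
    obtain ⟨-, h⟩ := mem_accCls_iff.1 he
    cases h with
    | refl =>
      obtain ⟨-, ⟨n, hn, hnN⟩, -⟩ := 𝒵.mem_tubeEdges_iff.1 he₀
      exact ⟨n, hn, 𝒵.not_oReach_of_mem_N hT hnN⟩
    | tail _ hst =>
      obtain ⟨-, -, v, -, hv, hvO⟩ := hst
      exact ⟨v, hv, hvO⟩
  acc_conn e he e' he' := by
    set S : Sym2 (Site 2) → Sym2 (Site 2) → Prop := fun a b =>
      a ∈ 𝒵.accCls X ω e₀ ∧ b ∈ 𝒵.accCls X ω e₀ ∧ ∃ w, w ∈ a ∧ w ∈ b ∧ w ∉ {v | OReach 𝒵.seeds X ω v} with hS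
    have hacc₀ : 𝒵.Acc X ω e₀ := acc_of_mem_tubeEdges he₀
    -- a chain of links from `e₀` is a chain of `S` (all its edges are in the class)
    have fromRep : ∀ {a}, ReflTransGen (𝒵.Lnk X ω) e₀ a → ReflTransGen S e₀ a := by
      intro a h
      induction h with
      | refl => exact ReflTransGen.refl
      | tail hab hst ih =>
        rename_i b c
        obtain ⟨hb, hc, w, hwb, hwc, hwO⟩ := hst
        exact ih.tail ⟨mem_accCls_iff.2 ⟨hb.mem_fresh, hab⟩, mem_accCls_iff.2 ⟨hc.mem_fresh, hab.tail ⟨hb, hc, w, hwb, hwc, hwO⟩⟩,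
          w, hwb, hwc, hwO⟩
    have Ssymm : ∀ {a b}, S a b → S b a := fun ⟨ha, hb, w, hwa, hwb, hwO⟩ => ⟨hb, ha, w, hwb, hwa, hwO⟩
    have RTsymm : ∀ {a b}, ReflTransGen S a b → ReflTransGen S b a := by
      intro a b h
      induction h with
      | refl => exact ReflTransGen.refl
      | tail _ hst ih => exact ReflTransGen.head (Ssymm hst) ih
    exact (RTsymm (fromRep (mem_accCls_iff.1 he).2)).trans (fromRep (mem_accCls_iff.1 he').2)
  esc_W u hu R := by
    have hu' : u ∉ 𝒵.K ∧ u ∉ 𝒵.N := ⟨fun h => hu (Or.inl h), fun h => hu (Or.inr h)⟩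
    obtain ⟨u', hfar, hwalk⟩ := hN.W_esc u hu'.1 hu'.2 R
    refine ⟨u', hfar, ?_⟩
    clear hfar
    induction hwalk with
    | refl => exact ReflTransGen.refl
    | tail _ hst ih =>
      obtain ⟨ha, hb, hk⟩ := hst
      exact ih.tail ⟨fun h => h.elim ha.1 ha.2, fun h => h.elim hb.1 hb.2, hk⟩
  esc_O v hv := by
    obtain ⟨s, hs, hchain⟩ := hv
    refine ⟨s, 𝒵.not_mem_Wv_of_mem_Far hs, ?_⟩
    clear hs
    induction hchain with
    | refl => exact ReflTransGen.refl
    | tail _ hst ih => exact ReflTransGen.head (by rw [Sym2.eq_swap]; exact ⟨hst.1, hst.2⟩) ih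
  esc_D f hf' := by
    rcases hf' with hf | ⟨q, hqf, hqSQ⟩
    swap
    · -- a square face: its square corner is outside the window
      refine ⟨f, ⟨q, ?_, hqf⟩, ReflTransGen.refl⟩
      rintro (h | h)
      · exact Finset.disjoint_left.1 𝒵.disjoint_K_SQ h hqSQ
      · exact Finset.disjoint_left.1 𝒵.disjoint_N_SQ h hqSQ
    obtain ⟨g, hg, hchain⟩ := hf
    refine ⟨g, ?_, ?_⟩
    · obtain ⟨u, hug, huF⟩ := hg
      exact ⟨u, 𝒵.not_mem_Wv_of_mem_Far huF, hug⟩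
    · have key : ∀ b, ReflTransGen (fun a b => ∃ e ∈ X, e ∉ ω ∧ e ∈ (zdGraph 2).edgeSet ∧ dualEdge e = s(a, b)) g b →
          ReflTransGen (fun a b => b ∈ {f | DReach 𝒵.seeds X ω f ∨ 𝒵.SqFace f} ∧ ∃ c ∈ {e : Sym2 (Site 2) | e ∈ X ∧ e ∉ ω},
            c ∈ (zdGraph 2).edgeSet ∧ IsFaceOf a c ∧ IsFaceOf b c) b g := by
        intro b hb
        induction hb with
        | refl => exact ReflTransGen.refl
        | tail hab hst ih =>
          rename_i a' b'
          obtain ⟨e, heX, heω, heE, hd⟩ := hst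
          have ha'D : DReach 𝒵.seeds X ω a' := ⟨g, hg, hab⟩
          exact ReflTransGen.head ⟨Or.inl ha'D, e, ⟨heX, heω⟩, heE, isFaceOf_right_of_dualEdge_eq hd,
            isFaceOf_left_of_dualEdge_eq hd⟩ ih
      exact key f hchain
  esc_P e heE hwin hh hcl hacc := by
    have heX : e ∉ X := fun h => by
      by_cases hω : e ∈ ω
      · exact hh ⟨h, hω⟩
      · exact hcl ⟨h, hω⟩
    have hacc₀ : 𝒵.Acc X ω e₀ := acc_of_mem_tubeEdges he₀
    -- the target relation is monotone: it only asks edges to be outside the class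
    set R : Sym2 (Site 2) → Sym2 (Site 2) → Prop := fun a b => b ∈ (zdGraph 2).edgeSet ∧ (∀ v ∈ b, v ∈ 𝒵.Wv) ∧
      ¬ (b ∈ X ∧ b ∈ ω) ∧ ¬ (b ∈ X ∧ b ∉ ω) ∧ b ∉ 𝒵.accCls X ω e₀ ∧ ∃ u, u ∈ a ∧ u ∈ b with hR
    by_cases hA : 𝒵.Acc X ω e
    · -- an accessible edge of ANOTHER class: walk back to its tube edge, then along the tube to a square
      obtain ⟨e₁, he₁, hch⟩ := hA
      -- every edge of the chain from `e₁` to `e` is accessible and outside the class of `e₀`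
      -- (else `e` would be in the class); record the chain backwards in `R`
      have notCls : ∀ {a b}, ReflTransGen (𝒵.AccStep X ω) a b → b ∉ 𝒵.accCls X ω e₀ → 𝒵.Acc X ω a →
          a ∉ 𝒵.accCls X ω e₀ := by
        intro a b h hb ha haCls
        apply hb
        clear hb
        induction h with
        | refl => exact haCls
        | tail hab hst ih =>
          obtain ⟨hcf, v, hvb, hvc, hvO⟩ := hst
          exact mem_accCls_step hacc₀ ih hcf hvb hvc hvO
      have heCls : e ∉ 𝒵.accCls X ω e₀ := hacc
      have back : ∀ {b}, ReflTransGen (𝒵.AccStep X ω) e₁ b → b ∉ 𝒵.accCls X ω e₀ → ReflTransGen R b e₁ := by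
        intro b h hb
        induction h with
        | refl => exact ReflTransGen.refl
        | tail hab hst ih =>
          rename_i b' c
          obtain ⟨hcf, v, hvb, hvc, hvO⟩ := hst
          have hb'acc : 𝒵.Acc X ω b' := ⟨e₁, he₁, hab⟩
          have hb'Cls : b' ∉ 𝒵.accCls X ω e₀ := fun h => hb (mem_accCls_step hacc₀ h hcf hvb hvc hvO)
          have hb'f : b' ∈ 𝒵.fresh X := hb'acc.mem_fresh
          have hb'E := 𝒵.mem_edgeSet_of_mem_fresh hb'f
          have hb'X : b' ∉ X := 𝒵.not_mem_of_mem_fresh hT.subset hb'f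
          refine ReflTransGen.head ⟨hb'E, fresh_endpoints' hT hN hb'f, fun h => hb'X h.1, fun h => hb'X h.1, hb'Cls,
            v, hvc, hvb⟩ (ih hb'Cls)
      have h1 : ReflTransGen R e e₁ := back hch heCls
      -- `e₁` is a tube edge outside the class; walk along its tube component to a square
      have he₁Cls : e₁ ∉ 𝒵.accCls X ω e₀ := notCls hch heCls (acc_of_mem_tubeEdges he₁)
      obtain ⟨-, ⟨n₁, hn₁e, hn₁N⟩, -⟩ := 𝒵.mem_tubeEdges_iff.1 he₁
      obtain ⟨n', hwalk, k, hk⟩ := hN.N_touch n₁ hn₁N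
      -- tube darts along the walk are accessible tube edges outside the class
      have tubeAcc : ∀ n ∈ 𝒵.N, ∀ k : Fin 4, n + cornerUnit k ∈ 𝒵.N → dartEdge n k ∈ 𝒵.tubeEdges := by
        intro n hn k hnk
        refine 𝒵.mem_tubeEdges_iff.2 ⟨dartEdge_mem_edgeSet n k, ⟨n, mem_dartEdge_iff.2 (Or.inl rfl), hn⟩, fun v hv => ?_⟩
        rcases mem_dartEdge_iff.1 hv with rfl | rfl
        · exact fun h => Finset.disjoint_left.1 𝒵.disjoint_N_SQ hn h
        · exact fun h => Finset.disjoint_left.1 𝒵.disjoint_N_SQ hnk h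
      -- invariant: current tube site `m` lies on an edge `a` outside the class reached by `R` from `e`
      have along : ∀ m, ReflTransGen (fun a b => a ∈ 𝒵.N ∧ b ∈ 𝒵.N ∧ ∃ k : Fin 4, b = a + cornerUnit k) n₁ m →
          ∃ a, a ∈ 𝒵.tubeEdges ∧ a ∉ 𝒵.accCls X ω e₀ ∧ m ∈ a ∧ ReflTransGen R e a := by
        intro m hm
        induction hm with
        | refl => exact ⟨e₁, he₁, he₁Cls, hn₁e, h1⟩
        | @tail m m' _ hst ih =>
          obtain ⟨hmN, hm'N, k', rfl⟩ := hst
          obtain ⟨a, ha, haCls, hma, hRa⟩ := ih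
          have hd : dartEdge m k' ∈ 𝒵.tubeEdges := tubeAcc m hmN k' hm'N
          have hdacc : 𝒵.Acc X ω (dartEdge m k') := acc_of_mem_tubeEdges hd
          have hmO : ¬ OReach 𝒵.seeds X ω m := 𝒵.not_oReach_of_mem_N hT hmN
          -- the dart is linked to `a` through the non-hub tube site `m`: same class status
          have haf : a ∈ 𝒵.fresh X := (acc_of_mem_tubeEdges (X := X) (ω := ω) ha).mem_fresh
          have hdCls : dartEdge m k' ∉ 𝒵.accCls X ω e₀ := fun h =>
            haCls (mem_accCls_step hacc₀ h haf (mem_dartEdge_iff.2 (Or.inl rfl)) hma hmO)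
          have hdf : dartEdge m k' ∈ 𝒵.fresh X := hdacc.mem_fresh
          have hdX : dartEdge m k' ∉ X := 𝒵.not_mem_of_mem_fresh hT.subset hdf
          refine ⟨dartEdge m k', hd, hdCls, mem_dartEdge_iff.2 (Or.inr rfl), hRa.tail ⟨dartEdge_mem_edgeSet _ _,
            fresh_endpoints' hT hN hdf, fun h => hdX h.1, fun h => hdX h.1, hdCls, m, hma, mem_dartEdge_iff.2 (Or.inl rfl)⟩⟩
      obtain ⟨a, -, -, hn'a, hRa⟩ := along n' hwalk
      exact ⟨a, n', hn'a, Or.inr (Or.inr ⟨k, hk⟩), hRa⟩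
    · -- a genuine pocket: the escape of `TileDataOfZones`, with the class in place of all accessible edges
      obtain ⟨e', u, hue', hend, hchain⟩ := 𝒵.exists_pocket_escape hT heE hwin heX hA
      refine ⟨e', u, hue', hend, ?_⟩
      refine reflTransGen_of_imp (fun a b hab => ?_) hchain
      obtain ⟨hbE, hbwin, hbo, hbc, hbacc, hu⟩ := hab
      refine ⟨hbE, hbwin, hbo, hbc, fun hb => hbacc ?_, hu⟩
      have hbA : 𝒵.Acc X ω b := acc_of_mem_accCls hacc₀ hb
      exact Finset.mem_filter.2 ⟨hbA.mem_fresh, hbA⟩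

/-! ### The family -/

/-- **The family of tile domains of the zones with squares wet by fiat**, indexed by the tube edges.
[cite: SchrammSmirnov2011, §4, proof of Prop. 4.1 (M')] -/
def tileFamilySq (hT : IsTerminal 𝒵.seeds X ω) (hN : 𝒵.Nice')
    (hASQ : ∀ w ∈ 𝒵.K, OReach 𝒵.seeds X ω w → ∀ f, TouchesFace w f → ¬ 𝒵.SqFace f) :
    TileFamily {e // e ∈ 𝒵.tubeEdges} where
  𝒯 i := 𝒵.tileDataClsSq hT hN hASQ i.2
  O := {v | OReach 𝒵.seeds X ω v}
  hubE := {e | e ∈ X ∧ e ∈ ω}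
  clE := {e | e ∈ X ∧ e ∉ ω}
  Wv := 𝒵.Wv
  O_eq _ := rfl
  hubE_eq _ := rfl
  clE_eq _ := rfl
  Wv_eq _ := rfl

/-- **The accessible edges of the family are all the accessible fresh edges.** [folklore] -/
theorem mem_accU_tileFamilySq_iff (hT : IsTerminal 𝒵.seeds X ω) (hN : 𝒵.Nice')
    (hASQ : ∀ w ∈ 𝒵.K, OReach 𝒵.seeds X ω w → ∀ f, TouchesFace w f → ¬ 𝒵.SqFace f) {e : Sym2 (Site 2)} :
    e ∈ (𝒵.tileFamilySq hT hN hASQ).accU ↔ 𝒵.Acc X ω e := by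
  rw [TileFamily.mem_accU_iff]
  constructor
  · rintro ⟨i, hi⟩
    exact acc_of_mem_accCls (acc_of_mem_tubeEdges i.2) hi
  · rintro ⟨e₁, he₁, hch⟩
    refine ⟨⟨e₁, he₁⟩, ?_⟩
    show e ∈ 𝒵.accCls X ω e₁
    induction hch with
    | refl => exact mem_accCls_self (acc_of_mem_tubeEdges he₁)
    | tail _ hst ih =>
      obtain ⟨hcf, v, hvb, hvc, hvO⟩ := hst
      exact mem_accCls_step (acc_of_mem_tubeEdges he₁) ih hcf hvb hvc hvO

/-- The accessible set of a member of the family is a class. [folklore] -/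
@[simp] theorem tileFamilySq_acc (hT : IsTerminal 𝒵.seeds X ω) (hN : 𝒵.Nice')
    (hASQ : ∀ w ∈ 𝒵.K, OReach 𝒵.seeds X ω w → ∀ f, TouchesFace w f → ¬ 𝒵.SqFace f) (i : {e // e ∈ 𝒵.tubeEdges}) :
    ((𝒵.tileFamilySq hT hN hASQ).𝒯 i).acc = 𝒵.accCls X ω i.1 := rfl

/-- The wet faces of a member of the family. [folklore] -/
@[simp] theorem tileFamilySq_Dset (hT : IsTerminal 𝒵.seeds X ω) (hN : 𝒵.Nice')
    (hASQ : ∀ w ∈ 𝒵.K, OReach 𝒵.seeds X ω w → ∀ f, TouchesFace w f → ¬ 𝒵.SqFace f) (i : {e // e ∈ 𝒵.tubeEdges}) :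
    ((𝒵.tileFamilySq hT hN hASQ).𝒯 i).Dset = {f | DReach 𝒵.seeds X ω f ∨ 𝒵.SqFace f} := rfl

end Zones

end Seeded

end Literature.Probability.Percolation

end
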